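import Mathlib
import Literature.Analysis.FunctionSpaces.BochnerRealEven
import HarnessLib

/-!
# Positive-definite functions on the `*`-semigroup `(0,∞) × V`: Bochner slices and their Laplace structure

Let `V` be a finite-dimensional real inner product space and `k : ℝ → V → ℝ` a function which is POSITIVE DEFINITE on
the `*`-semigroup `((0,∞) × V, +, (t,z)* = (t,-z))` in the real form delivered by reflection positivity,
`∑ᵢⱼ cᵢ cⱼ k(tᵢ + tⱼ)(zᵢ − zⱼ) ≥ 0` (`tᵢ > 0`, real `cᵢ`; written out, no definition), even in `z`, continuous in `z`
for each `t > 0`, with `t ↦ k t 0` bounded on every `[t₀,∞)`.  These are exactly the hypotheses satisfied by the restriction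
`k t z = K(t, z⃗)` of a reflection-positive Euclidean two-point kernel to the open half-space [cite: GlimmJaffeQP1987, §6.2],
and the theorems below are the two one-variable halves of its Laplace–Fourier (Källén–Lehmann type) representation
`k(t, z) = ∫ e^{-tE} cos⟪q, z⟫ dμ(E, q)` [cite: BergChristensenRessel1984, Ch. 4 §4]:

* `exists_bochnerSlice` — BOCHNER SLICES: for every `t > 0` a finite positive measure `m_t` on `V` with
  `charFun m_t = k t` (so `k t z = ∫ cos⟪q, z⟫ dm_t`, `m_t(V) = k t 0`);
* `bochnerSlice_sum_mul_mul_nonneg` — the family `t ↦ m_t` is POSITIVE DEFINITE AS A MEASURE-VALUED FUNCTION on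
  `((0,∞),+)`: `∑ᵢⱼ dᵢ dⱼ m_{sᵢ+sⱼ}(B) ≥ 0` for every set `B` (Fourier positivity
  `exists_finiteMeasure_eq_add_of_charFun_sub_realPosDef` applied to the positive and negative parts of the combination);
Consequently (Widder's theorem in measure form, continuity automatic: companion file `LaplaceFourierSliceLaplace.lean`)
every `t ↦ m_t(B)` is the Laplace transform of one positive measure `λ_B` on `[0,∞)`; what then remains for the joint measure
`μ` on `[0,∞) × V` is the assembly of the positive bimeasure `(A, B) ↦ λ_B(A)`.  THEOREMS ONLY; Mathlib + tree; no `sorry`; standard axioms.  Motivation in the tree: stub `stub_laplaceFourier` of LINE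
g18-A on crux ⟨stmt-QuantumFields-23125⟩ (`F4SubCurvatureDoor.RationalToGeneral`).
-/

noncomputable section

open MeasureTheory Complex Set
open scoped ComplexConjugate InnerProductSpace NNReal ENNReal

namespace Literature.Analysis.FunctionSpaces

variable {V : Type*} [NormedAddCommGroup V] [InnerProductSpace ℝ V] [FiniteDimensional ℝ V]
  [MeasurableSpace V] [BorelSpace V]

/-! ### Re-indexing the positive-definiteness hypothesis -/

omit [InnerProductSpace ℝ V] [FiniteDimensional ℝ V] [MeasurableSpace V] [BorelSpace V] in
/-- The defining inequality for families indexed by an arbitrary finite type. [folklore] -/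
private theorem semigroupProd_sum_nonneg {k : ℝ → V → ℝ}
    (hPD : ∀ (m : ℕ) (t : Fin m → ℝ) (z : Fin m → V) (c : Fin m → ℝ), (∀ i, 0 < t i) →
      0 ≤ ∑ i, ∑ j, c i * c j * k (t i + t j) (z i - z j))
    {ι : Type*} [Fintype ι] (t : ι → ℝ) (z : ι → V) (c : ι → ℝ) (ht : ∀ a, 0 < t a) :
    0 ≤ ∑ a, ∑ b, c a * c b * k (t a + t b) (z a - z b) := by
  classical
  set e := (Fintype.equivFin ι).symm with he
  have h' := hPD (Fintype.card ι) (t ∘ e) (z ∘ e) (c ∘ e) fun a => ht _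
  simp only [Function.comp_apply] at h'
  rwa [Equiv.sum_comp e (fun a => ∑ j, c a * c (e j) * k (t a + t (e j)) (z a - z (e j))),
    show (∑ a, ∑ j, c a * c (e j) * k (t a + t (e j)) (z a - z (e j))) =
      ∑ a, ∑ b, c a * c b * k (t a + t b) (z a - z b) from
      Finset.sum_congr rfl fun a _ => Equiv.sum_comp e (fun b => c a * c b * k (t a + t b) (z a - z b))] at h'

/-! ### Bochner slices -/

/-- **Bochner slices.**  For `k` positive definite on the `*`-semigroup `(0,∞) × V` (real form), even and continuous in
`z`, every slice `k t` (`t > 0`) is the characteristic function of a finite positive measure `m_t` on `V`.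
[cite: BergChristensenRessel1984, Ch. 4 §4] [cite: Bochner1933, Satz 22] -/
theorem exists_bochnerSlice {k : ℝ → V → ℝ}
    (hPD : ∀ (m : ℕ) (t : Fin m → ℝ) (z : Fin m → V) (c : Fin m → ℝ), (∀ i, 0 < t i) →
      0 ≤ ∑ i, ∑ j, c i * c j * k (t i + t j) (z i - z j))
    (heven : ∀ t z, k t (-z) = k t z) (hcont : ∀ t, 0 < t → Continuous (k t)) {t : ℝ} (ht : 0 < t) :
    ∃ m : Measure V, IsFiniteMeasure m ∧ ∀ z, charFun m z = k t z := by
  refine exists_finiteMeasure_charFun_eq_of_realPosDef (k t) (hcont t ht) (fun n z c => ?_) (heven t)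
  have h := hPD n (fun _ => t / 2) z c fun _ => by positivity
  simpa [add_halves] using h

/-! ### The slices form a positive-definite measure-valued function on `(0,∞)` -/

omit [FiniteDimensional ℝ V] in
/-- Characteristic function of a finite combination `∑ᵢⱼ wᵢⱼ • μᵢⱼ` with `ℝ≥0` weights. [folklore] -/
private theorem charFun_sum_sum_smul {n : ℕ} (w : Fin n → Fin n → ℝ≥0) (μ : Fin n → Fin n → Measure V)
    (hμ : ∀ i j, IsFiniteMeasure (μ i j)) (z : V) :
    charFun (∑ i, ∑ j, w i j • μ i j) z = ∑ i, ∑ j, (w i j : ℝ) * charFun (μ i j) z := by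
  have hint : ∀ (ρ : Measure V) [IsFiniteMeasure ρ], Integrable (fun x : V => Complex.exp (⟪x, z⟫_ℝ * I)) ρ := by
    intro ρ _
    refine (integrable_const (1 : ℝ)).mono' (by fun_prop) (ae_of_all _ fun x => ?_)
    rw [Complex.norm_exp_ofReal_mul_I]
  simp only [charFun_apply]
  rw [integral_finsetSum_measure fun i _ => ?_]
  · refine Finset.sum_congr rfl fun i _ => ?_
    rw [integral_finsetSum_measure fun j _ => ?_]
    · refine Finset.sum_congr rfl fun j _ => ?_
      haveI := hμ i j
      rw [integral_smul_nnreal_measure, NNReal.smul_def, Complex.real_smul]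
    · haveI := hμ i j
      exact (hint (μ i j)).smul_measure ENNReal.coe_ne_top
  · refine (integrable_finsetSum_measure.2 fun j _ => ?_)
    haveI := hμ i j
    exact (hint (μ i j)).smul_measure ENNReal.coe_ne_top

/-- **The Bochner slices are a positive-definite measure-valued function on `((0,∞),+)`**: if `m_t` (`t > 0`) are finite
measures with `charFun m_t = k t` for `k` positive definite on the `*`-semigroup `(0,∞) × V` (real form), then for all
`sᵢ > 0`, real `dᵢ` and every set `B`, `∑ᵢⱼ dᵢ dⱼ m_{sᵢ+sⱼ}(B) ≥ 0`.  (Split the combination into its positive and negative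
parts `M₊, M₋`; `charFun M₊ − charFun M₋ = ∑ dᵢdⱼ k(sᵢ+sⱼ)` is real positive definite by the semigroup hypothesis on the index
set `Fin n × Fin p`; Fourier positivity gives `M₋ ≤ M₊`.) [cite: BergChristensenRessel1984, Ch. 4 §4] -/
theorem bochnerSlice_sum_mul_mul_nonneg {k : ℝ → V → ℝ}
    (hPD : ∀ (m : ℕ) (t : Fin m → ℝ) (z : Fin m → V) (c : Fin m → ℝ), (∀ i, 0 < t i) →
      0 ≤ ∑ i, ∑ j, c i * c j * k (t i + t j) (z i - z j))
    {m : ℝ → Measure V} (hm : ∀ t, 0 < t → IsFiniteMeasure (m t) ∧ ∀ z, charFun (m t) z = k t z)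
    {n : ℕ} (s d : Fin n → ℝ) (hs : ∀ i, 0 < s i) (B : Set V) :
    0 ≤ ∑ i, ∑ j, d i * d j * ((m (s i + s j)) B).toReal := by
  haveI hfin : ∀ i j : Fin n, IsFiniteMeasure (m (s i + s j)) := fun i j => (hm _ (add_pos (hs i) (hs j))).1
  -- positive and negative parts of the combination
  set wp : Fin n → Fin n → ℝ≥0 := fun i j => (d i * d j).toNNReal with hwp
  set wm : Fin n → Fin n → ℝ≥0 := fun i j => (-(d i * d j)).toNNReal with hwm
  have hw : ∀ i j, (wp i j : ℝ) - wm i j = d i * d j := fun i j => by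
    simp only [hwp, hwm, Real.coe_toNNReal']
    rw [max_zero_sub_max_neg_zero_eq_self]
  set Mp : Measure V := ∑ i, ∑ j, wp i j • m (s i + s j) with hMp
  set Mm : Measure V := ∑ i, ∑ j, wm i j • m (s i + s j) with hMm
  have hfinS : ∀ (w : Fin n → Fin n → ℝ≥0), IsFiniteMeasure (∑ i, ∑ j, w i j • m (s i + s j)) := by
    intro w
    refine ⟨?_⟩
    simp only [Measure.coe_finsetSum, Measure.coe_smul, Finset.sum_apply, Pi.smul_apply]
    refine ENNReal.sum_lt_top.2 fun i _ => ENNReal.sum_lt_top.2 fun j _ => ?_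
    exact ENNReal.mul_lt_top ENNReal.coe_lt_top (measure_lt_top _ _)
  haveI : IsFiniteMeasure Mp := hfinS wp
  haveI : IsFiniteMeasure Mm := hfinS wm
  -- the difference of the characteristic functions is the positive-definite combination
  have hψ : ∀ z, charFun Mp z - charFun Mm z = ((∑ i, ∑ j, d i * d j * k (s i + s j) z : ℝ) : ℂ) := by
    intro z
    rw [hMp, hMm, charFun_sum_sum_smul wp _ hfin, charFun_sum_sum_smul wm _ hfin, ← Finset.sum_sub_distrib]
    push_cast
    refine Finset.sum_congr rfl fun i _ => ?_
    rw [← Finset.sum_sub_distrib]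
    refine Finset.sum_congr rfl fun j _ => ?_
    rw [(hm _ (add_pos (hs i) (hs j))).2 z, ← sub_mul, ← Complex.ofReal_sub, hw]
    push_cast; ring
  have hPDψ : ∀ (p : ℕ) (z : Fin p → V) (c : Fin p → ℝ),
      0 ≤ ∑ a, ∑ b, c a * c b * (∑ i, ∑ j, d i * d j * k (s i + s j) (z a - z b)) := by
    intro p z c
    have h := semigroupProd_sum_nonneg hPD (ι := Fin n × Fin p) (fun q => s q.1) (fun q => z q.2)
      (fun q => d q.1 * c q.2) fun q => hs q.1
    have e : (∑ a, ∑ b, c a * c b * ∑ i, ∑ j, d i * d j * k (s i + s j) (z a - z b)) =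
        ∑ i, ∑ a, ∑ j, ∑ b, (d i * c a) * (d j * c b) * k (s i + s j) (z a - z b) := by
      calc (∑ a, ∑ b, c a * c b * ∑ i, ∑ j, d i * d j * k (s i + s j) (z a - z b))
          = ∑ a, ∑ b, ∑ i, ∑ j, (d i * c a) * (d j * c b) * k (s i + s j) (z a - z b) := by
            refine Finset.sum_congr rfl fun a _ => Finset.sum_congr rfl fun b _ => ?_
            rw [Finset.mul_sum]
            refine Finset.sum_congr rfl fun i _ => ?_
            rw [Finset.mul_sum]
            refine Finset.sum_congr rfl fun j _ => ?_
            ring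
        _ = ∑ a, ∑ i, ∑ b, ∑ j, (d i * c a) * (d j * c b) * k (s i + s j) (z a - z b) := by
            refine Finset.sum_congr rfl fun a _ => ?_
            rw [Finset.sum_comm]
        _ = ∑ i, ∑ a, ∑ b, ∑ j, (d i * c a) * (d j * c b) * k (s i + s j) (z a - z b) := Finset.sum_comm
        _ = ∑ i, ∑ a, ∑ j, ∑ b, (d i * c a) * (d j * c b) * k (s i + s j) (z a - z b) := by
            refine Finset.sum_congr rfl fun i _ => Finset.sum_congr rfl fun a _ => ?_
            rw [Finset.sum_comm]
    rw [e]
    simpa only [Fintype.sum_prod_type] using h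
  obtain ⟨π, hπ, hMM⟩ := exists_finiteMeasure_eq_add_of_charFun_sub_realPosDef
    (fun z => ∑ i, ∑ j, d i * d j * k (s i + s j) z) hψ hPDψ
  -- evaluate at `B`
  have hle : Mm B ≤ Mp B := by
    rw [hMM, Measure.add_apply]
    exact le_self_add
  have hval : ∀ (w : Fin n → Fin n → ℝ≥0), ((∑ i, ∑ j, w i j • m (s i + s j)) B).toReal =
      ∑ i, ∑ j, (w i j : ℝ) * ((m (s i + s j)) B).toReal := by
    intro w
    simp only [Measure.coe_finsetSum, Measure.coe_smul, Finset.sum_apply, Pi.smul_apply]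
    rw [ENNReal.toReal_sum fun i _ => ?_]
    · refine Finset.sum_congr rfl fun i _ => ?_
      rw [ENNReal.toReal_sum fun j _ => ?_]
      · refine Finset.sum_congr rfl fun j _ => ?_
        rw [ENNReal.smul_def, smul_eq_mul, ENNReal.toReal_mul, ENNReal.coe_toReal]
      · exact ENNReal.mul_ne_top ENNReal.coe_ne_top (measure_ne_top _ _)
    · exact ENNReal.sum_ne_top.2 fun j _ => ENNReal.mul_ne_top ENNReal.coe_ne_top (measure_ne_top _ _)
  have hdiff : ∑ i, ∑ j, d i * d j * ((m (s i + s j)) B).toReal = (Mp B).toReal - (Mm B).toReal := by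
    rw [hMp, hMm, hval wp, hval wm, ← Finset.sum_sub_distrib]
    refine Finset.sum_congr rfl fun i _ => ?_
    rw [← Finset.sum_sub_distrib]
    refine Finset.sum_congr rfl fun j _ => ?_
    rw [← sub_mul, hw]
  rw [hdiff, sub_nonneg]
  exact ENNReal.toReal_mono (measure_ne_top _ _) hle

end Literature.Analysis.FunctionSpaces

end
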